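import Literature.Topology.FourManifolds.HCobordismCancellationFrame
import HarnessLib

/-!
# Milnor 1965, proof of Thm. 5.4, Assertion 6, the general case: smoothness, domains and local
# inverses of `h`, `h₀` and `h₀⁻¹h` in the level coordinates

Topic `Literature/Topology/FourManifolds` (fact seat
`provefact-Literature.Topology.FourManifolds.Cobord-8b1ec36bf6`, tenure on
`Literature.Topology.FourManifolds.Cobordism.Milnor1965_cancellation_modelChart`; sequel of
`HCobordismCancellationFrame.lean`).  Everything here is **proved**; no named facts.

Milnor, *Lectures on the h-cobordism theorem* (1965), proof of Thm. 5.4, Assertion 6 (held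
copy, PDF pp. 31–32): `h : f⁻¹(b₁) → f⁻¹(b₂)` (along `ξ`) and `h' : U₁ → U₂` (along `η⃗`) are
diffeomorphisms, `h₀ = g₂ h' g₁⁻¹`, and Thm. 5.6 is applied to `h₀⁻¹h` near `p₁`.  For the
frame `D` of `HCobordismCancellationFrame.lean` this file records, in the level coordinates
`Rᵃ × Rᵇ` at `p₁` and `p₂`:

* the model translation `h'` (`D.Λ`) and its inverse (`D.Λ'`): where the flow line meets the
  other level (`HitsUp`, `HitsDown`, open conditions) they are smooth, mutually inverse,
  preserve the two coordinate planes and the axis, and exchange the axis points `t₁e₀`, `t₂e₀`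
  (`Λ_t₁`, `Λ'_t₂`);
* open neighbourhoods of `0` (`domΛ`, `domΛ'`, `domH`, `domH'`, `domΦ`, `domΦ'`) on which the
  coordinate expressions `Λc`, `Λcinv` (of `h₀`, `h₀⁻¹`), `Hc`, `Hcinv` (of `h`, `h⁻¹`) and
  `Φ = Λcinv ∘ Hc`, `Φinv` (of `h₀⁻¹h` and its inverse) are smooth and mutually inverse, all
  fixing `0`;
* the two identities that drive the isotopy argument: `h₀ ∘ lift₁ ∘ Φ = h ∘ lift₁`
  (`h₀_lift₁_Φ`: deforming `Φ` to the identity deforms `h` to `h₀`), and hypothesis 2) of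
  Thm. 5.6 for `Φ`: a point `(u, 0)` of `Rᵃ = S_R(b₁)` with `Φ(u, 0) ∈ Rᵇ = h₀⁻¹S_L'(b₂)` is
  the origin (`eq_zero_of_Φ_fst_eq_zero`, from `S_R(b₂) ∩ S_L'(b₂) = {p₂}`).

## References

* J. Milnor, *Lectures on the h-cobordism theorem*, notes by L. Siebenmann and J. Sondow,
  Princeton Mathematical Notes (1965): proof of Thm. 5.4, Assertion 6 (PDF pp. 30–32),
  Thm. 5.6 (PDF p. 32).  Held: `lit read book:milnornd-lectures-h-cobordism-theorem`.
  [MilnorHCobordism1965]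
-/

open scoped Manifold ContDiff Topology NNReal
open Set Function Filter

noncomputable section

namespace Literature.Topology.FourManifolds

open Flow

universe u

/-- Local notation: `𝔼 n` is the model Euclidean space `EuclideanSpace ℝ (Fin n)`. -/
local notation "𝔼 " n:arg => EuclideanSpace ℝ (Fin n)

variable {n : ℕ} {M N : Type u} [TopologicalSpace M] [ChartedSpace (𝔼 n) M]
  [TopologicalSpace N] [ChartedSpace (𝔼 n) N]

namespace Cobordism

namespace CancellationFrame

variable {c : Cobordism n M N} {f : c.W → ℝ}
  {ξ : Cₛ^∞⟮𝓡∂ (n + 1); 𝔼 (n + 1), (TangentSpace (𝓡∂ (n + 1)) : c.W → Type)⟯}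
  {p p' : c.W} {k : ℕ} {v : ℝ → ℝ} {b₁ b₂ : ℝ}
  (D : CancellationFrame c f ξ p p' k v b₁ b₂)

/-! ### The model translation `h'` between the levels `F = b₁` and `F = b₂` -/

/-- The flow line of `x` under the model flow meets the level `F = b₂`. [cite: MilnorHCobordism1965, proof of Thm. 5.4, Assertion 6 (PDF p. 31)] -/
def HitsUp (x : 𝔼 (n + 1)) : Prop :=
  Hits (cancellationFlow k v D.profile) (milnorCancellationMorse k (lipschitzProfile v) (f p)) b₂ x

/-- The flow line of `x` under the model flow meets the level `F = b₁`. [cite: MilnorHCobordism1965, proof of Thm. 5.4, Assertion 6 (PDF p. 31)] -/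
def HitsDown (x : 𝔼 (n + 1)) : Prop :=
  Hits (cancellationFlow k v D.profile) (milnorCancellationMorse k (lipschitzProfile v) (f p)) b₁ x

section Model

variable {x y : 𝔼 (n + 1)}

/-- `h'` lands on the level `F = b₂`. [cite: MilnorHCobordism1965, proof of Thm. 5.4, Assertion 6 (PDF p. 31)] -/
theorem apply_Λ (hx : D.HitsUp x) : milnorCancellationMorse k (lipschitzProfile v) (f p) (D.Λ x) = b₂ :=
  apply_cancellationLevelProj k D.profile (f p) hx

/-- `h'⁻¹` lands on the level `F = b₁`. [cite: MilnorHCobordism1965, proof of Thm. 5.4, Assertion 6 (PDF p. 31)] -/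
theorem apply_Λ' (hy : D.HitsDown y) : milnorCancellationMorse k (lipschitzProfile v) (f p) (D.Λ' y) = b₁ :=
  apply_cancellationLevelProj k D.profile (f p) hy

/-- **`h'` is smooth** where the flow line meets the level. [cite: MilnorHCobordism1965, proof of Thm. 5.4, Assertion 6 (PDF p. 31)] -/
theorem contDiffAt_Λ (hx : D.HitsUp x) : ContDiffAt ℝ ∞ D.Λ x :=
  contDiffAt_cancellationLevelProj k D.profile (f p) D.hb₂ hx

/-- `h'⁻¹` is smooth where the flow line meets the level. [cite: MilnorHCobordism1965, proof of Thm. 5.4, Assertion 6 (PDF p. 31)] -/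
theorem contDiffAt_Λ' (hy : D.HitsDown y) : ContDiffAt ℝ ∞ D.Λ' y :=
  contDiffAt_cancellationLevelProj k D.profile (f p) D.hb₁ hy

/-- Meeting the level `b₂` is an open condition. [cite: MilnorHCobordism1965, proof of Thm. 5.4, Assertion 4 (PDF p. 29)] -/
theorem isOpen_hitsUp : IsOpen {x | D.HitsUp x} :=
  isOpen_iff_mem_nhds.2 fun _ hx => hits_mem_nhds_cancellationFlow k D.profile (f p) D.hb₂ hx

/-- Meeting the level `b₁` is an open condition. [cite: MilnorHCobordism1965, proof of Thm. 5.4, Assertion 4 (PDF p. 29)] -/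
theorem isOpen_hitsDown : IsOpen {y | D.HitsDown y} :=
  isOpen_iff_mem_nhds.2 fun _ hy => hits_mem_nhds_cancellationFlow k D.profile (f p) D.hb₁ hy

/-- **`h'⁻¹ ∘ h' = id` on the level `F = b₁`.** [cite: MilnorHCobordism1965, proof of Thm. 5.4, Assertion 6 (PDF p. 31)] -/
theorem Λ'_Λ (hx : milnorCancellationMorse k (lipschitzProfile v) (f p) x = b₁) : D.Λ' (D.Λ x) = x :=
  cancellationLevelProj_cancellationLevelProj k D.profile (f p) b₂ D.hb₁ hx

/-- **`h' ∘ h'⁻¹ = id` on the level `F = b₂`.** [cite: MilnorHCobordism1965, proof of Thm. 5.4, Assertion 6 (PDF p. 31)] -/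
theorem Λ_Λ' (hy : milnorCancellationMorse k (lipschitzProfile v) (f p) y = b₂) : D.Λ (D.Λ' y) = y :=
  cancellationLevelProj_cancellationLevelProj k D.profile (f p) b₁ D.hb₂ hy

/-- `h'` preserves the vanishing of each coordinate `x_i`, `i ≠ 0` (planes and axis). [cite: MilnorHCobordism1965, proof of Thm. 5.4, Assertion 6 (PDF p. 31)] -/
theorem Λ_apply_eq_zero_iff (x : 𝔼 (n + 1)) {i : Fin (n + 1)} (hi : (i : ℕ) ≠ 0) :
    D.Λ x i = 0 ↔ x i = 0 :=
  cancellationLevelProj_apply_eq_zero_iff k D.profile (f p) b₂ x hi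

/-- `h'⁻¹` preserves the vanishing of each coordinate `x_i`, `i ≠ 0`. [cite: MilnorHCobordism1965, proof of Thm. 5.4, Assertion 6 (PDF p. 31)] -/
theorem Λ'_apply_eq_zero_iff (y : 𝔼 (n + 1)) {i : Fin (n + 1)} (hi : (i : ℕ) ≠ 0) :
    D.Λ' y i = 0 ↔ y i = 0 :=
  cancellationLevelProj_apply_eq_zero_iff k D.profile (f p) b₁ y hi

/-- `h'` keeps `x₀ ∈ (0, 1)`. [cite: MilnorHCobordism1965, proof of Thm. 5.4, Assertion 6 (PDF p. 31)] -/
theorem Λ_apply_zero_mem (hx : x 0 ∈ Ioo (0 : ℝ) 1) : D.Λ x 0 ∈ Ioo (0 : ℝ) 1 :=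
  cancellationLevelProj_apply_zero_mem_Ioo k D.profile (f p) b₂ hx

/-- `h'⁻¹` keeps `x₀ ∈ (0, 1)`. [cite: MilnorHCobordism1965, proof of Thm. 5.4, Assertion 6 (PDF p. 31)] -/
theorem Λ'_apply_zero_mem (hy : y 0 ∈ Ioo (0 : ℝ) 1) : D.Λ' y 0 ∈ Ioo (0 : ℝ) 1 :=
  cancellationLevelProj_apply_zero_mem_Ioo k D.profile (f p) b₁ hy

/-- The flow line of `h'(x)` meets the level `b₁` again (at `x`). [folklore] -/
theorem hitsDown_Λ (hx : milnorCancellationMorse k (lipschitzProfile v) (f p) x = b₁) : D.HitsDown (D.Λ x) := by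
  refine ⟨-(cancellationLevelTime k v D.profile (f p) b₂ x), ?_⟩
  show milnorCancellationMorse k (lipschitzProfile v) (f p) (cancellationFlow k v D.profile
    (-(cancellationLevelTime k v D.profile (f p) b₂ x), cancellationLevelProj k v D.profile (f p) b₂ x)) = b₁
  rw [cancellationLevelProj_apply, cancellationFlow, modelFlow_neg_modelFlow]
  exact hx

/-- The flow line of `h'⁻¹(y)` meets the level `b₂` again (at `y`). [folklore] -/
theorem hitsUp_Λ' (hy : milnorCancellationMorse k (lipschitzProfile v) (f p) y = b₂) : D.HitsUp (D.Λ' y) := by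
  refine ⟨-(cancellationLevelTime k v D.profile (f p) b₁ y), ?_⟩
  show milnorCancellationMorse k (lipschitzProfile v) (f p) (cancellationFlow k v D.profile
    (-(cancellationLevelTime k v D.profile (f p) b₁ y), cancellationLevelProj k v D.profile (f p) b₁ y)) = b₂
  rw [cancellationLevelProj_apply, cancellationFlow, modelFlow_neg_modelFlow]
  exact hy

/-- A trajectory segment of Milnor's field `η⃗` runs from `x` (on or below the level, with
`0 < x₀ < 1`) to `h'(x)`. [cite: MilnorHCobordism1965, proof of Thm. 5.4, Assertion 6 (PDF p. 31)] -/
theorem flowsTo_Λ (hx0 : x 0 ∈ Ioo (0 : ℝ) 1)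
    (hxb : milnorCancellationMorse k (lipschitzProfile v) (f p) x ≤ b₂) (hx : D.HitsUp x) :
    FlowsTo 𝓘(ℝ, 𝔼 (n + 1))
      (fun y : 𝔼 (n + 1) => (milnorCancellationField k v y : TangentSpace 𝓘(ℝ, 𝔼 (n + 1)) y))
      x (D.Λ x) :=
  flowsTo_cancellationLevelProj k D.profile (f p) hx0 hxb hx

end Model

/-! ### The axis -/

/-- `F(t₁e₀) = b₁` for the modified profile. [cite: MilnorHCobordism1965, proof of Thm. 5.4, Assertion 6, (b) (PDF p. 30)] -/
theorem morse_t₁ : milnorCancellationMorse k (lipschitzProfile v) (f p)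
    (D.t₁ • EuclideanSpace.single (0 : Fin (n + 1)) (1 : ℝ)) = b₁ := by
  rw [milnorCancellationMorse_lipschitzProfile_of_mem_Ioo k (f p) (by simpa using D.t₁_mem)]
  exact D.lower.apply_smul_single

/-- `F(t₂e₀) = b₂` for the modified profile. [cite: MilnorHCobordism1965, proof of Thm. 5.4, Assertion 6, (b) (PDF p. 30)] -/
theorem morse_t₂ : milnorCancellationMorse k (lipschitzProfile v) (f p)
    (D.t₂ • EuclideanSpace.single (0 : Fin (n + 1)) (1 : ℝ)) = b₂ := by
  rw [milnorCancellationMorse_lipschitzProfile_of_mem_Ioo k (f p) (by simpa using D.t₂_mem)]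
  exact D.upper.apply_smul_single

/-- The flow line of `t₁e₀` meets the level `b₂`. [cite: MilnorHCobordism1965, proof of Thm. 5.4, Assertion 6 (PDF p. 31)] -/
theorem hitsUp_t₁ : D.HitsUp (D.t₁ • EuclideanSpace.single (0 : Fin (n + 1)) (1 : ℝ)) :=
  hits_smul_single k D.profile (f p) D.t₁_mem (by rw [D.morse_t₁]; exact D.hb.le) D.hb₂.2

/-- **`h'(t₁e₀) = t₂e₀`**: `h'` maps the axis point of the level `b₁` to that of the level `b₂`
(*"points on the segment `oe` [go] to points on `T`"*). [cite: MilnorHCobordism1965, proof of Thm. 5.4, Assertion 6 (PDF pp. 30–31)] -/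
theorem Λ_t₁ : D.Λ (D.t₁ • EuclideanSpace.single (0 : Fin (n + 1)) (1 : ℝ)) =
    D.t₂ • EuclideanSpace.single (0 : Fin (n + 1)) (1 : ℝ) := by
  obtain ⟨σ, hσ, h1, h2⟩ := cancellationLevelProj_smul_single k D.profile (f p) D.t₁_mem D.hitsUp_t₁
  have hmono := strictMonoOn_milnorCancellationMorse_smul_single (m := n + 1) k
    D.profile.lipschitzProfile (f p)
  have hσt : σ = D.t₂ :=
    hmono.injOn (Ioo_subset_Icc_self hσ) (Ioo_subset_Icc_self D.t₂_mem) (h2.trans D.morse_t₂.symm)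
  rw [← hσt]
  exact h1

/-- `h'⁻¹(t₂e₀) = t₁e₀`. [cite: MilnorHCobordism1965, proof of Thm. 5.4, Assertion 6 (PDF pp. 30–31)] -/
theorem Λ'_t₂ : D.Λ' (D.t₂ • EuclideanSpace.single (0 : Fin (n + 1)) (1 : ℝ)) =
    D.t₁ • EuclideanSpace.single (0 : Fin (n + 1)) (1 : ℝ) := by
  rw [← D.Λ_t₁]
  exact D.Λ'_Λ D.morse_t₁

/-- The flow line of `t₂e₀` meets the level `b₁`. [folklore] -/
theorem hitsDown_t₂ : D.HitsDown (D.t₂ • EuclideanSpace.single (0 : Fin (n + 1)) (1 : ℝ)) := by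
  rw [← D.Λ_t₁]
  exact D.hitsDown_Λ D.morse_t₁

/-- **`Λc 0 = 0`**: `h₀` fixes the origin of the level coordinates (`h₀ p₁ = p₂`). [cite: MilnorHCobordism1965, proof of Thm. 5.4, Assertion 6 (PDF p. 31)] -/
theorem Λc_zero : D.Λc 0 = 0 := by
  show splitCoords n k D.hk (D.Λ (D.S₁.symm (0, 0))) = 0
  rw [D.S₁_symm_zero, D.Λ_t₁, splitCoords_smul_single]

/-- `Λcinv 0 = 0`. [cite: MilnorHCobordism1965, proof of Thm. 5.4, Assertion 6 (PDF p. 31)] -/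
theorem Λcinv_zero : D.Λcinv 0 = 0 := by
  show splitCoords n k D.hk (D.Λ' (D.S₂.symm (0, 0))) = 0
  rw [D.S₂_symm_zero, D.Λ'_t₂, splitCoords_smul_single]

/-- **`Φ 0 = 0`** (hypothesis 1) of Thm. 5.6 for `h₀⁻¹h`). [cite: MilnorHCobordism1965, Thm. 5.6 1) (PDF p. 32)] -/
theorem Φ_zero : D.Φ 0 = 0 := by
  show D.Λcinv (D.Hc 0) = 0
  rw [D.Hc_zero, D.Λcinv_zero]

/-- `Φinv 0 = 0`. [cite: MilnorHCobordism1965, Thm. 5.6 1) (PDF p. 32)] -/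
theorem Φinv_zero : D.Φinv 0 = 0 := by
  show D.Hcinv (D.Λc 0) = 0
  rw [D.Λc_zero, D.Hcinv_zero]

/-! ### `h₀` in coordinates: domains, smoothness, inverses -/

/-- The domain of `Λc`: coordinates `y` with `(0, y) ∈ S₁.target` whose level point flows to
the level `b₂` inside `S₂.source`. [folklore] -/
def domΛ : Set (𝔼 (n - k) × 𝔼 k) :=
  D.dom₁ ∩ (fun y => D.S₁.symm (0, y)) ⁻¹' {x | D.HitsUp x ∧ D.Λ x ∈ D.S₂.source}

/-- The domain of `Λcinv`. [folklore] -/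
def domΛ' : Set (𝔼 (n - k) × 𝔼 k) :=
  D.dom₂ ∩ (fun y => D.S₂.symm (0, y)) ⁻¹' {x | D.HitsDown x ∧ D.Λ' x ∈ D.S₁.source}

/-- `0 ∈ domΛ`. [folklore] -/
theorem zero_mem_domΛ : (0 : 𝔼 (n - k) × 𝔼 k) ∈ D.domΛ := by
  refine ⟨D.zero_mem_dom₁, ?_⟩
  show D.HitsUp (D.S₁.symm (0, 0)) ∧ D.Λ (D.S₁.symm (0, 0)) ∈ D.S₂.source
  rw [D.S₁_symm_zero, D.Λ_t₁]
  exact ⟨D.hitsUp_t₁, D.mem₂⟩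

/-- `0 ∈ domΛ'`. [folklore] -/
theorem zero_mem_domΛ' : (0 : 𝔼 (n - k) × 𝔼 k) ∈ D.domΛ' := by
  refine ⟨D.zero_mem_dom₂, ?_⟩
  show D.HitsDown (D.S₂.symm (0, 0)) ∧ D.Λ' (D.S₂.symm (0, 0)) ∈ D.S₁.source
  rw [D.S₂_symm_zero, D.Λ'_t₂]
  exact ⟨D.hitsDown_t₂, D.mem₁⟩

/-- `y ↦ S₁⁻¹(0, y)` is continuous on `dom₁`. [folklore] -/
theorem continuousOn_symm₁ : ContinuousOn (fun y : 𝔼 (n - k) × 𝔼 k => D.S₁.symm (0, y)) D.dom₁ :=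
  fun _ hy => ((D.S₁.continuousAt_symm hy).comp
    (continuous_const.prodMk continuous_id).continuousAt).continuousWithinAt

/-- `y ↦ S₂⁻¹(0, y)` is continuous on `dom₂`. [folklore] -/
theorem continuousOn_symm₂ : ContinuousOn (fun y : 𝔼 (n - k) × 𝔼 k => D.S₂.symm (0, y)) D.dom₂ :=
  fun _ hy => ((D.S₂.continuousAt_symm hy).comp
    (continuous_const.prodMk continuous_id).continuousAt).continuousWithinAt

/-- `domΛ` is open. [folklore] -/
theorem isOpen_domΛ : IsOpen D.domΛ := by
  refine D.continuousOn_symm₁.isOpen_inter_preimage D.isOpen_dom₁ ?_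
  refine isOpen_iff_mem_nhds.2 fun x hx => inter_mem (D.isOpen_hitsUp.mem_nhds hx.1) ?_
  exact (D.contDiffAt_Λ hx.1).continuousAt.preimage_mem_nhds (D.S₂.open_source.mem_nhds hx.2)

/-- `domΛ'` is open. [folklore] -/
theorem isOpen_domΛ' : IsOpen D.domΛ' := by
  refine D.continuousOn_symm₂.isOpen_inter_preimage D.isOpen_dom₂ ?_
  refine isOpen_iff_mem_nhds.2 fun x hx => inter_mem (D.isOpen_hitsDown.mem_nhds hx.1) ?_
  exact (D.contDiffAt_Λ' hx.1).continuousAt.preimage_mem_nhds (D.S₁.open_source.mem_nhds hx.2)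

section Coord

variable {y : 𝔼 (n - k) × 𝔼 k}

/-- **`Λc` is smooth on `domΛ`.** [cite: MilnorHCobordism1965, proof of Thm. 5.4, Assertion 6 (PDF p. 31)] -/
theorem contDiffAt_Λc (hy : y ∈ D.domΛ) : ContDiffAt ℝ ∞ D.Λc y :=
  (splitCoords n k D.hk).contDiff.contDiffAt.comp y ((D.contDiffAt_Λ hy.2.1).comp y
    ((D.level₁.contDiffAt_symm hy.1).comp y (contDiffAt_const.prodMk contDiffAt_id)))

/-- `Λcinv` is smooth on `domΛ'`. [cite: MilnorHCobordism1965, proof of Thm. 5.4, Assertion 6 (PDF p. 31)] -/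
theorem contDiffAt_Λcinv (hy : y ∈ D.domΛ') : ContDiffAt ℝ ∞ D.Λcinv y :=
  (splitCoords n k D.hk).contDiff.contDiffAt.comp y ((D.contDiffAt_Λ' hy.2.1).comp y
    ((D.level₂.contDiffAt_symm hy.1).comp y (contDiffAt_const.prodMk contDiffAt_id)))

/-- **`Λcinv ∘ Λc = id` on `domΛ`.** [cite: MilnorHCobordism1965, proof of Thm. 5.4, Assertion 6 (PDF p. 31)] -/
theorem Λcinv_Λc (hy : y ∈ D.domΛ) : D.Λcinv (D.Λc y) = y := by
  obtain ⟨hy₁, hhit, hS₂⟩ := hy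
  have hx₁ : milnorCancellationMorse k (lipschitzProfile v) (f p) (D.S₁.symm (0, y)) = b₁ :=
    D.level₁.apply_symm_zero hy₁
  show splitCoords n k D.hk (D.Λ' (D.S₂.symm (0, splitCoords n k D.hk (D.Λ (D.S₁.symm (0, y)))))) = y
  rw [D.level₂.symm_zero_splitCoords hS₂ (D.apply_Λ hhit), D.Λ'_Λ hx₁]
  exact D.level₁.splitCoords_symm hy₁

/-- **`Λc ∘ Λcinv = id` on `domΛ'`.** [cite: MilnorHCobordism1965, proof of Thm. 5.4, Assertion 6 (PDF p. 31)] -/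
theorem Λc_Λcinv (hy : y ∈ D.domΛ') : D.Λc (D.Λcinv y) = y := by
  obtain ⟨hy₂, hhit, hS₁⟩ := hy
  have hx₂ : milnorCancellationMorse k (lipschitzProfile v) (f p) (D.S₂.symm (0, y)) = b₂ :=
    D.level₂.apply_symm_zero hy₂
  show splitCoords n k D.hk (D.Λ (D.S₁.symm (0, splitCoords n k D.hk (D.Λ' (D.S₂.symm (0, y)))))) = y
  rw [D.level₁.symm_zero_splitCoords hS₁ (D.apply_Λ' hhit), D.Λ_Λ' hx₂]
  exact D.level₂.splitCoords_symm hy₂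

/-- `Λc` maps `domΛ` into `dom₂`. [folklore] -/
theorem Λc_mem_dom₂ (hy : y ∈ D.domΛ) : D.Λc y ∈ D.dom₂ := by
  obtain ⟨-, hhit, hS₂⟩ := hy
  have : D.S₂ (D.Λ (D.S₁.symm (0, y))) = (0, D.Λc y) := by
    rw [D.level₂.apply, D.apply_Λ hhit, sub_self]
    rfl
  show ((0 : ℝ), D.Λc y) ∈ D.S₂.target
  rw [← this]
  exact D.S₂.map_source hS₂

/-- `Λcinv` maps `domΛ'` into `dom₁`. [folklore] -/
theorem Λcinv_mem_dom₁ (hy : y ∈ D.domΛ') : D.Λcinv y ∈ D.dom₁ := by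
  obtain ⟨-, hhit, hS₁⟩ := hy
  have : D.S₁ (D.Λ' (D.S₂.symm (0, y))) = (0, D.Λcinv y) := by
    rw [D.level₁.apply, D.apply_Λ' hhit, sub_self]
    rfl
  show ((0 : ℝ), D.Λcinv y) ∈ D.S₁.target
  rw [← this]
  exact D.S₁.map_source hS₁

/-- The level point of `Λcinv y` is `h'⁻¹` of the level point of `y`. [folklore] -/
theorem symm_Λcinv (hy : y ∈ D.domΛ') : D.S₁.symm (0, D.Λcinv y) = D.Λ' (D.S₂.symm (0, y)) :=
  D.level₁.symm_zero_splitCoords hy.2.2 (D.apply_Λ' hy.2.1)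

/-- The level point of `Λc y` is `h'` of the level point of `y`. [folklore] -/
theorem symm_Λc (hy : y ∈ D.domΛ) : D.S₂.symm (0, D.Λc y) = D.Λ (D.S₁.symm (0, y)) :=
  D.level₂.symm_zero_splitCoords hy.2.2 (D.apply_Λ hy.2.1)

/-- **`Λcinv` preserves `Rᵇ = {u = 0}`** (the plane `x_{k+1} = ⋯ = 0` is invariant under
`h'⁻¹`; `Rᵇ` corresponds to `h₀⁻¹S_L'(b₂)`). [cite: MilnorHCobordism1965, proof of Thm. 5.4, Assertion 6 (PDF p. 31)] -/
theorem Λcinv_fst_eq_zero (hy : y ∈ D.domΛ') (h1 : y.1 = 0) : (D.Λcinv y).1 = 0 := by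
  have hsplit : splitCoords n k D.hk (D.S₂.symm (0, y)) = y := D.level₂.splitCoords_symm hy.1
  have hx : ∀ i : Fin (n + 1), k < (i : ℕ) → D.S₂.symm (0, y) i = 0 := by
    rw [← splitCoords_fst_eq_zero_iff (hk := D.hk), hsplit]
    exact h1
  show (splitCoords n k D.hk (D.Λ' (D.S₂.symm (0, y)))).1 = 0
  rw [splitCoords_fst_eq_zero_iff]
  intro i hi
  exact (D.Λ'_apply_eq_zero_iff _ (by omega)).2 (hx i hi)

/-- `Λc` preserves `Rᵇ = {u = 0}`. [cite: MilnorHCobordism1965, proof of Thm. 5.4, Assertion 6 (PDF p. 31)] -/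
theorem Λc_fst_eq_zero (hy : y ∈ D.domΛ) (h1 : y.1 = 0) : (D.Λc y).1 = 0 := by
  have hsplit : splitCoords n k D.hk (D.S₁.symm (0, y)) = y := D.level₁.splitCoords_symm hy.1
  have hx : ∀ i : Fin (n + 1), k < (i : ℕ) → D.S₁.symm (0, y) i = 0 := by
    rw [← splitCoords_fst_eq_zero_iff (hk := D.hk), hsplit]
    exact h1
  show (splitCoords n k D.hk (D.Λ (D.S₁.symm (0, y)))).1 = 0
  rw [splitCoords_fst_eq_zero_iff]
  intro i hi
  exact (D.Λ_apply_eq_zero_iff _ (by omega)).2 (hx i hi)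

/-- `Λcinv` preserves `Rᵃ = {v = 0}` as well (the plane `x₁ = ⋯ = x_k = 0`). [cite: MilnorHCobordism1965, proof of Thm. 5.4, Assertion 6 (PDF p. 31)] -/
theorem Λcinv_snd_eq_zero (hy : y ∈ D.domΛ') (h2 : y.2 = 0) : (D.Λcinv y).2 = 0 := by
  have hsplit : splitCoords n k D.hk (D.S₂.symm (0, y)) = y := D.level₂.splitCoords_symm hy.1
  have hx : ∀ i : Fin (n + 1), (i : ℕ) ≠ 0 → (i : ℕ) ≤ k → D.S₂.symm (0, y) i = 0 := by
    rw [← splitCoords_snd_eq_zero_iff (hk := D.hk), hsplit]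
    exact h2
  show (splitCoords n k D.hk (D.Λ' (D.S₂.symm (0, y)))).2 = 0
  rw [splitCoords_snd_eq_zero_iff]
  intro i hi hik
  exact (D.Λ'_apply_eq_zero_iff _ hi).2 (hx i hi hik)

end Coord

/-! ### `h` in coordinates: domains, smoothness, inverses -/

/-- The domain of `Hc`: coordinates `y ∈ dom₁` with `h (lift₁ y)` in the chart domain of `g₂`
and in the level chart at `p₂`. [folklore] -/
def domH : Set (𝔼 (n - k) × 𝔼 k) :=
  D.dom₁ ∩ (fun y => D.h (D.lift₁ y)) ⁻¹' (D.G₂.source ∩ D.G₂ ⁻¹' D.S₂.source)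

/-- The domain of `Hcinv`. [folklore] -/
def domH' : Set (𝔼 (n - k) × 𝔼 k) :=
  D.dom₂ ∩ (fun y => D.hinv (D.lift₂ y)) ⁻¹' (D.G₁.source ∩ D.G₁ ⁻¹' D.S₁.source)

/-- `0 ∈ domH`. [folklore] -/
theorem zero_mem_domH : (0 : 𝔼 (n - k) × 𝔼 k) ∈ D.domH := by
  refine ⟨D.zero_mem_dom₁, ?_⟩
  show D.h (D.lift₁ 0) ∈ D.G₂.source ∩ D.G₂ ⁻¹' D.S₂.source
  rw [D.lift₁_zero, D.h_p₁]
  refine ⟨D.p₂_mem, ?_⟩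
  show D.G₂ D.p₂ ∈ D.S₂.source
  rw [D.G₂_p₂]
  exact D.mem₂

/-- `0 ∈ domH'`. [folklore] -/
theorem zero_mem_domH' : (0 : 𝔼 (n - k) × 𝔼 k) ∈ D.domH' := by
  refine ⟨D.zero_mem_dom₂, ?_⟩
  show D.hinv (D.lift₂ 0) ∈ D.G₁.source ∩ D.G₁ ⁻¹' D.S₁.source
  rw [D.lift₂_zero, D.hinv_p₂]
  refine ⟨D.p₁_mem, ?_⟩
  show D.G₁ D.p₁ ∈ D.S₁.source
  rw [D.G₁_p₁]
  exact D.mem₁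

section H

variable {y : 𝔼 (n - k) × 𝔼 k}

/-- **`lift₁` is smooth on `dom₁`** (as a map into `W`). [folklore] -/
theorem contMDiffAt_lift₁ (hy : y ∈ D.dom₁) :
    ContMDiffAt 𝓘(ℝ, 𝔼 (n - k) × 𝔼 k) (𝓡∂ (n + 1)) ∞ D.lift₁ y :=
  (D.lower.contMDiffOn_symm.contMDiffAt (D.G₁.open_target.mem_nhds (D.symm_mem_target₁ hy).1)).comp y
    (((D.level₁.contDiffAt_symm hy).comp y (contDiffAt_const.prodMk contDiffAt_id)).contMDiffAt)

/-- `lift₂` is smooth on `dom₂`. [folklore] -/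
theorem contMDiffAt_lift₂ (hy : y ∈ D.dom₂) :
    ContMDiffAt 𝓘(ℝ, 𝔼 (n - k) × 𝔼 k) (𝓡∂ (n + 1)) ∞ D.lift₂ y :=
  (D.upper.contMDiffOn_symm.contMDiffAt (D.G₂.open_target.mem_nhds (D.symm_mem_target₂ hy).1)).comp y
    (((D.level₂.contDiffAt_symm hy).comp y (contDiffAt_const.prodMk contDiffAt_id)).contMDiffAt)

/-- **`ψ₁` is smooth on `G₁.source`.** [folklore] -/
theorem contMDiffAt_ψ₁ {z : c.W} (hz : z ∈ D.G₁.source) :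
    ContMDiffAt (𝓡∂ (n + 1)) 𝓘(ℝ, 𝔼 (n - k) × 𝔼 k) ∞ D.ψ₁ z :=
  (splitCoords n k D.hk).contDiff.contMDiff.contMDiffAt.comp z
    (D.lower.contMDiffOn.contMDiffAt (D.G₁.open_source.mem_nhds hz))

/-- `ψ₂` is smooth on `G₂.source`. [folklore] -/
theorem contMDiffAt_ψ₂ {z : c.W} (hz : z ∈ D.G₂.source) :
    ContMDiffAt (𝓡∂ (n + 1)) 𝓘(ℝ, 𝔼 (n - k) × 𝔼 k) ∞ D.ψ₂ z :=
  (splitCoords n k D.hk).contDiff.contMDiff.contMDiffAt.comp z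
    (D.upper.contMDiffOn.contMDiffAt (D.G₂.open_source.mem_nhds hz))

/-- `lift₁` is continuous on `dom₁`. [folklore] -/
theorem continuousOn_lift₁ : ContinuousOn D.lift₁ D.dom₁ :=
  fun _ hy => (D.contMDiffAt_lift₁ hy).continuousAt.continuousWithinAt

/-- `lift₂` is continuous on `dom₂`. [folklore] -/
theorem continuousOn_lift₂ : ContinuousOn D.lift₂ D.dom₂ :=
  fun _ hy => (D.contMDiffAt_lift₂ hy).continuousAt.continuousWithinAt

/-- `domH` is open. [folklore] -/
theorem isOpen_domH : IsOpen D.domH := by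
  refine ContinuousOn.isOpen_inter_preimage ?_ D.isOpen_dom₁ (D.G₂.isOpen_inter_preimage D.S₂.open_source)
  exact fun y hy => ((D.contMDiffAt_h (D.f_lift₁_mem hy)).continuousAt.comp
    (D.contMDiffAt_lift₁ hy).continuousAt).continuousWithinAt

/-- `domH'` is open. [folklore] -/
theorem isOpen_domH' : IsOpen D.domH' := by
  refine ContinuousOn.isOpen_inter_preimage ?_ D.isOpen_dom₂ (D.G₁.isOpen_inter_preimage D.S₁.open_source)
  exact fun y hy => ((D.contMDiffAt_hinv (D.f_lift₂_mem hy)).continuousAt.comp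
    (D.contMDiffAt_lift₂ hy).continuousAt).continuousWithinAt

/-- **`Hc` is smooth on `domH`.** [cite: MilnorHCobordism1965, proof of Thm. 5.4, Assertion 6 (PDF p. 31)] -/
theorem contDiffAt_Hc (hy : y ∈ D.domH) : ContDiffAt ℝ ∞ D.Hc y :=
  contMDiffAt_iff_contDiffAt.1 <| (D.contMDiffAt_ψ₂ hy.2.1).comp y
    ((D.contMDiffAt_h (D.f_lift₁_mem hy.1)).comp y (D.contMDiffAt_lift₁ hy.1))

/-- `Hcinv` is smooth on `domH'`. [cite: MilnorHCobordism1965, proof of Thm. 5.4, Assertion 6 (PDF p. 31)] -/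
theorem contDiffAt_Hcinv (hy : y ∈ D.domH') : ContDiffAt ℝ ∞ D.Hcinv y :=
  contMDiffAt_iff_contDiffAt.1 <| (D.contMDiffAt_ψ₁ hy.2.1).comp y
    ((D.contMDiffAt_hinv (D.f_lift₂_mem hy.1)).comp y (D.contMDiffAt_lift₂ hy.1))

/-- **`h ∘ lift₁ = lift₂ ∘ Hc` on `domH`** (`h(lift₁ y)` is the level point with coordinates
`Hc y`). [folklore] -/
theorem h_lift₁ (hy : y ∈ D.domH) : D.h (D.lift₁ y) = D.lift₂ (D.Hc y) :=
  (D.lift₂_ψ₂ hy.2.1 hy.2.2 (D.f_h (D.f_lift₁_mem hy.1))).symm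

/-- `h⁻¹ ∘ lift₂ = lift₁ ∘ Hcinv` on `domH'`. [folklore] -/
theorem hinv_lift₂ (hy : y ∈ D.domH') : D.hinv (D.lift₂ y) = D.lift₁ (D.Hcinv y) :=
  (D.lift₁_ψ₁ hy.2.1 hy.2.2 (D.f_hinv (D.f_lift₂_mem hy.1))).symm

/-- `Hc` maps `domH` into `dom₂`. [folklore] -/
theorem Hc_mem_dom₂ (hy : y ∈ D.domH) : D.Hc y ∈ D.dom₂ :=
  D.ψ₂_mem_dom₂ hy.2.1 hy.2.2 (D.f_h (D.f_lift₁_mem hy.1))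

/-- `Hcinv` maps `domH'` into `dom₁`. [folklore] -/
theorem Hcinv_mem_dom₁ (hy : y ∈ D.domH') : D.Hcinv y ∈ D.dom₁ :=
  D.ψ₁_mem_dom₁ hy.2.1 hy.2.2 (D.f_hinv (D.f_lift₂_mem hy.1))

/-- **`Hcinv ∘ Hc = id` on `domH`.** [cite: MilnorHCobordism1965, proof of Thm. 5.4, Assertion 6 (PDF p. 31)] -/
theorem Hcinv_Hc (hy : y ∈ D.domH) : D.Hcinv (D.Hc y) = y := by
  show D.ψ₁ (D.hinv (D.lift₂ (D.Hc y))) = y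
  rw [← D.h_lift₁ hy, D.hinv_h (D.f_lift₁ hy.1), D.ψ₁_lift₁ hy.1]

/-- **`Hc ∘ Hcinv = id` on `domH'`.** [cite: MilnorHCobordism1965, proof of Thm. 5.4, Assertion 6 (PDF p. 31)] -/
theorem Hc_Hcinv (hy : y ∈ D.domH') : D.Hc (D.Hcinv y) = y := by
  show D.ψ₂ (D.h (D.lift₁ (D.Hcinv y))) = y
  rw [← D.hinv_lift₂ hy, D.h_hinv (D.f_lift₂ hy.1), D.ψ₂_lift₂ hy.1]

/-- **`Hc` carries `Rᵃ` into the coordinates of `S_R(b₂)`**: the level point of `Hc(u, 0)` lies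
on `S_R(b₂) = h(S_R(b₁))`. [cite: MilnorHCobordism1965, proof of Thm. 5.4, Assertion 6 (PDF p. 31)] -/
theorem lift₂_Hc_mem_rightHandSphere {u : 𝔼 (n - k)} (hu : (u, (0 : 𝔼 k)) ∈ D.domH) :
    D.lift₂ (D.Hc (u, 0)) ∈ rightHandSphere (𝓡∂ (n + 1)) f ξ p b₂ := by
  rw [← D.h_lift₁ hu]
  exact D.h_mem_rightHandSphere (D.lift₁_mem_rightHandSphere hu.1)

end H

/-! ### `h₀⁻¹h` in coordinates -/

/-- The domain of `Φ = Λcinv ∘ Hc`. [folklore] -/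
def domΦ : Set (𝔼 (n - k) × 𝔼 k) := D.domH ∩ D.Hc ⁻¹' D.domΛ'

/-- The domain of `Φinv = Hcinv ∘ Λc`. [folklore] -/
def domΦ' : Set (𝔼 (n - k) × 𝔼 k) := D.domΛ ∩ D.Λc ⁻¹' D.domH'

/-- `0 ∈ domΦ`. [folklore] -/
theorem zero_mem_domΦ : (0 : 𝔼 (n - k) × 𝔼 k) ∈ D.domΦ :=
  ⟨D.zero_mem_domH, by show D.Hc 0 ∈ D.domΛ'; rw [D.Hc_zero]; exact D.zero_mem_domΛ'⟩

/-- `0 ∈ domΦ'`. [folklore] -/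
theorem zero_mem_domΦ' : (0 : 𝔼 (n - k) × 𝔼 k) ∈ D.domΦ' :=
  ⟨D.zero_mem_domΛ, by show D.Λc 0 ∈ D.domH'; rw [D.Λc_zero]; exact D.zero_mem_domH'⟩

/-- `domΦ` is open. [folklore] -/
theorem isOpen_domΦ : IsOpen D.domΦ :=
  ContinuousOn.isOpen_inter_preimage (fun _ hy => (D.contDiffAt_Hc hy).continuousAt.continuousWithinAt)
    D.isOpen_domH D.isOpen_domΛ'

/-- `domΦ'` is open. [folklore] -/
theorem isOpen_domΦ' : IsOpen D.domΦ' :=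
  ContinuousOn.isOpen_inter_preimage (fun _ hy => (D.contDiffAt_Λc hy).continuousAt.continuousWithinAt)
    D.isOpen_domΛ D.isOpen_domH'

/-- `domΦ` is a neighbourhood of `0`. [folklore] -/
theorem domΦ_mem_nhds : D.domΦ ∈ 𝓝 (0 : 𝔼 (n - k) × 𝔼 k) := D.isOpen_domΦ.mem_nhds D.zero_mem_domΦ

/-- `domΦ'` is a neighbourhood of `0`. [folklore] -/
theorem domΦ'_mem_nhds : D.domΦ' ∈ 𝓝 (0 : 𝔼 (n - k) × 𝔼 k) := D.isOpen_domΦ'.mem_nhds D.zero_mem_domΦ'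

section Phi

variable {y : 𝔼 (n - k) × 𝔼 k}

/-- **`Φ = h₀⁻¹h` (in coordinates) is smooth on `domΦ`.** [cite: MilnorHCobordism1965, proof of Thm. 5.4, Assertion 6 (PDF pp. 31–32)] -/
theorem contDiffAt_Φ (hy : y ∈ D.domΦ) : ContDiffAt ℝ ∞ D.Φ y :=
  (D.contDiffAt_Λcinv hy.2).comp y (D.contDiffAt_Hc hy.1)

/-- `Φinv` is smooth on `domΦ'`. [cite: MilnorHCobordism1965, proof of Thm. 5.4, Assertion 6 (PDF pp. 31–32)] -/
theorem contDiffAt_Φinv (hy : y ∈ D.domΦ') : ContDiffAt ℝ ∞ D.Φinv y :=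
  (D.contDiffAt_Hcinv hy.2).comp y (D.contDiffAt_Λc hy.1)

/-- **`Φinv ∘ Φ = id` on `domΦ`.** [cite: MilnorHCobordism1965, proof of Thm. 5.4, Assertion 6 (PDF pp. 31–32)] -/
theorem Φinv_Φ (hy : y ∈ D.domΦ) : D.Φinv (D.Φ y) = y := by
  show D.Hcinv (D.Λc (D.Λcinv (D.Hc y))) = y
  rw [D.Λc_Λcinv hy.2, D.Hcinv_Hc hy.1]

/-- **`Φ ∘ Φinv = id` on `domΦ'`.** [cite: MilnorHCobordism1965, proof of Thm. 5.4, Assertion 6 (PDF pp. 31–32)] -/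
theorem Φ_Φinv (hy : y ∈ D.domΦ') : D.Φ (D.Φinv y) = y := by
  show D.Λcinv (D.Hc (D.Hcinv (D.Λc y))) = y
  rw [D.Hc_Hcinv hy.2, D.Λcinv_Λc hy.1]

/-- `Φ` is smooth on a neighbourhood of `0`. [cite: MilnorHCobordism1965, proof of Thm. 5.4, Assertion 6 (PDF pp. 31–32)] -/
theorem eventually_contDiffAt_Φ : ∀ᶠ y in 𝓝 (0 : 𝔼 (n - k) × 𝔼 k), ContDiffAt ℝ ∞ D.Φ y :=
  Filter.mem_of_superset D.domΦ_mem_nhds fun _ hy => D.contDiffAt_Φ hy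

/-- `Φinv ∘ Φ = id` near `0`. [cite: MilnorHCobordism1965, proof of Thm. 5.4, Assertion 6 (PDF pp. 31–32)] -/
theorem eventually_Φinv_Φ : ∀ᶠ y in 𝓝 (0 : 𝔼 (n - k) × 𝔼 k), D.Φinv (D.Φ y) = y :=
  Filter.mem_of_superset D.domΦ_mem_nhds fun _ hy => D.Φinv_Φ hy

/-- `Φ ∘ Φinv = id` near `0`. [cite: MilnorHCobordism1965, proof of Thm. 5.4, Assertion 6 (PDF pp. 31–32)] -/
theorem eventually_Φ_Φinv : ∀ᶠ y in 𝓝 (0 : 𝔼 (n - k) × 𝔼 k), D.Φ (D.Φinv y) = y :=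
  Filter.mem_of_superset D.domΦ'_mem_nhds fun _ hy => D.Φ_Φinv hy

/-- **`h₀ ∘ lift₁ ∘ Φ = h ∘ lift₁` on `domΦ`**: in the level, `h₀ ∘ (h₀⁻¹h) = h`; this is the
identity by which an isotopy of `Φ = h₀⁻¹h` to a map equal to the identity near `0` deforms
`h` to a map equal to `h₀` near `p₁`. [cite: MilnorHCobordism1965, proof of Thm. 5.4, Assertion 6 (PDF p. 32)] -/
theorem h₀_lift₁_Φ (hy : y ∈ D.domΦ) : D.h₀ (D.lift₁ (D.Φ y)) = D.h (D.lift₁ y) := by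
  obtain ⟨hyH, hyΛ⟩ := hy
  have hyΛ' : D.Hc y ∈ D.domΛ' := hyΛ
  have hx₂ : milnorCancellationMorse k (lipschitzProfile v) (f p) (D.S₂.symm (0, D.Hc y)) = b₂ :=
    D.level₂.apply_symm_zero hyΛ'.1
  have hx₁ : D.Λ' (D.S₂.symm (0, D.Hc y)) ∈ D.G₁.target := (D.source₁ hyΛ'.2.2).1
  show D.G₂.symm (D.Λ (D.G₁ (D.G₁.symm (D.S₁.symm (0, D.Λcinv (D.Hc y)))))) = D.h (D.lift₁ y)
  rw [D.symm_Λcinv hyΛ', D.G₁.right_inv hx₁, D.Λ_Λ' hx₂, D.h_lift₁ hyH]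
  rfl

/-- **Hypothesis 2) of Thm. 5.6 for `Φ = h₀⁻¹h`: `Φ(Rᵃ)` meets `Rᵇ` only at the origin** (on
`domΦ`).  For `Φ(u, 0) ∈ Rᵇ` the level point `h(lift₁(u, 0))` lies on `S_R(b₂)` (image of
`Rᵃ = S_R(b₁)` under `h`) and on `S_L'(b₂)` (its `g₂`-coordinates have vanishing unstable
block, because `h'⁻¹` preserves that plane), hence is `p₂ = h(p₁)`, so `(u, 0) = ψ₁(p₁) = 0`.
[cite: MilnorHCobordism1965, proof of Thm. 5.4, Assertion 6 (PDF pp. 31–32); Thm. 5.6 2) (PDF p. 32)] -/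
theorem eq_zero_of_Φ_fst_eq_zero {u : 𝔼 (n - k)} (hu : (u, (0 : 𝔼 k)) ∈ D.domΦ)
    (h0 : (D.Φ (u, 0)).1 = 0) : u = 0 := by
  obtain ⟨huH, huΛ⟩ := hu
  have huΛ' : D.Hc (u, 0) ∈ D.domΛ' := huΛ
  -- the `g₂`-coordinates of `y₂ = h (lift₁ (u, 0))` have vanishing unstable block
  set x₂ : 𝔼 (n + 1) := D.S₂.symm (0, D.Hc (u, 0)) with hx₂
  have hsplit : splitCoords n k D.hk x₂ = D.Hc (u, 0) := D.level₂.splitCoords_symm huΛ'.1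
  have hΛ'x₂ : ∀ i : Fin (n + 1), k < (i : ℕ) → D.Λ' x₂ i = 0 := by
    rw [← splitCoords_fst_eq_zero_iff]
    exact h0
  have hx₂u : (splitCoords n k D.hk x₂).1 = 0 := by
    rw [splitCoords_fst_eq_zero_iff]
    intro i hi
    exact (D.Λ'_apply_eq_zero_iff x₂ (by omega)).1 (hΛ'x₂ i hi)
  -- hence `y₂ ∈ S_L'(b₂)`; also `y₂ ∈ S_R(b₂)`; so `y₂ = p₂`
  have hy₂ : D.lift₂ (D.Hc (u, 0)) = D.h (D.lift₁ (u, 0)) := (D.h_lift₁ huH).symm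
  have hmem₂ : D.Hc (u, 0) ∈ D.dom₂ := D.Hc_mem_dom₂ huH
  have hL : D.lift₂ (D.Hc (u, 0)) ∈ leftHandSphere (𝓡∂ (n + 1)) f ξ p' b₂ := by
    refine D.mem_leftHandSphere_of_ψ₂ (D.lift₂_mem hmem₂) (D.f_lift₂ hmem₂) ?_
    rw [D.ψ₂_lift₂ hmem₂, ← hsplit]
    exact hx₂u
  have hR : D.lift₂ (D.Hc (u, 0)) ∈ rightHandSphere (𝓡∂ (n + 1)) f ξ p b₂ :=
    D.lift₂_Hc_mem_rightHandSphere huH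
  have hp₂ : D.h (D.lift₁ (u, 0)) = D.p₂ := by
    rw [← hy₂]
    have : D.lift₂ (D.Hc (u, 0)) ∈ ({D.p₂} : Set c.W) := D.inter₂ ▸ ⟨hR, hL⟩
    exact this
  -- apply `h⁻¹` and read off the coordinates
  have hp₁ : D.lift₁ (u, 0) = D.p₁ := by
    rw [← D.hinv_h (D.f_lift₁ huH.1), hp₂, D.hinv_p₂]
  have h0' : ((u, (0 : 𝔼 k)) : 𝔼 (n - k) × 𝔼 k) = 0 := by
    rw [← D.ψ₁_lift₁ huH.1, hp₁, D.ψ₁_p₁]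
  exact (Prod.mk.inj h0').1

end Phi

end CancellationFrame

end Cobordism

end Literature.Topology.FourManifolds
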